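import Mathlib
import Literature.Barriers.ValiantsHypothesis.AlgebraicNaturalProofs
import Literature.Computability.AlgebraicComplexity.ArithCircuitProofs
import Summits.ValiantsHypothesis.ValiantsHypothesis.Theorems.BarrierLeverPartitionMinorsHitByVPProductStates
import Summits.ValiantsHypothesis.ValiantsHypothesis.Theorems.BarrierLeverPartitionMinorsHitByVPCorankRepair

/-!
# Route BarrierLever — item `PartitionMinorsHitByVP` (stmt-ValiantsHypothesis-19717):
# AUTOMORPHIC layouts (columns = image of the rows under a cube automorphism) are hit, `b = 2`

Helper file (`--supports stmt-ValiantsHypothesis-19717`; cell valiant-natproofs, rung V4, 𝒟-side,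
prover seat valiant-natproofs-prover gen 6). Definition-free. Closes NO item.

A cube automorphism `T = (σ, s)` of `{0,1}^h` acts on subsets by `S ↦ σ(S ∆ s)` (translate by `s`,
then permute coordinates by `σ`). The TWISTED DIAGONAL PRODUCT STATE
`f_T = ∏_{a ∉ s} (1 + x_a y_{σ a}) · ∏_{a ∈ s} (y_{σ a} + x_a)` (written below as one product of
`if`-factors) has `coeff_{x^U y^W} f_T = [W = σ(U ∆ s)]` (`coeff_twistedDiag`), degree `≤ 2h` and size
`≤ 3h`, so `f_T ∈ SmallCircuits ℂ (h+h) 2` for `h ≥ 1` (`twistedDiag_mem_smallCircuits`).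

**Theorem (`partitionMinor_hit_of_automorphic`).** If the column family is the `T`-image of a
rearrangement of the (injective) row family, `w j = σ((u (κ j)) ∆ s)` for a permutation `κ` of
`Fin r`, then the layout matrix of item 19717 at `f_T` is the permutation matrix of `κ⁻¹`, hence
nonsingular: every AUTOMORPHIC layout, of any size `r ≤ 2^h`, is hit inside `SmallCircuits ℂ (h+h) 2`.
This extends the principal-type class (`T = id`, `…ProductStateSums.partitionMinor_hit_of_principal`,
seat val-np-p3) to translates (`σ = id`; e.g. even-weight rows vs odd-weight columns, `s = {a}`),
pointwise complements (`s = univ`) and coordinate relabelings; it is the partition-matrix counterpart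
of the TT-level `…Compression.tt_layout_of_relabeling` / `tt_layout_compl` (seat val-np-p2).

WHAT THIS IS NOT: nothing for layouts that are not automorphic images (the content of item 19717);
nothing on crux 14610.
-/

set_option linter.dupNamespace false

namespace Summit.ValiantsHypothesis.ValiantsHypothesis.Theorems.BarrierLever.Automorphic

open Finset MvPolynomial
open Literature.Barriers.ValiantsHypothesis Literature.Computability.AlgebraicComplexity
open Summit.ValiantsHypothesis.ValiantsHypothesis.Theorems.BarrierLever.ProductStateSums
  (castAdd_ne_natAdd partitionExpo_apply_castAdd partitionExpo_apply_natAdd)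
open Summit.ValiantsHypothesis.ValiantsHypothesis.Theorems.BarrierLever.CorankRepair
  (partitionExpo_eq_iff prod_X_mul_prod_X_eq_monomial)

noncomputable section

variable {h : ℕ}

/-- The `x`-part and the `x`-free part of a twisted factor. -/
theorem twistedFactor_eq_add (σ : Equiv.Perm (Fin h)) (s : Finset (Fin h)) (a : Fin h) :
    ((if a ∈ s then X (Fin.natAdd h (σ a)) + X (Fin.castAdd h a)
      else 1 + X (Fin.castAdd h a) * X (Fin.natAdd h (σ a))) : MvPolynomial (Fin (h + h)) ℂ) =
    (X (Fin.castAdd h a) * if a ∈ s then 1 else X (Fin.natAdd h (σ a))) +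
      (if a ∈ s then X (Fin.natAdd h (σ a)) else 1) := by
  by_cases ha : a ∈ s <;> simp [ha] <;> ring

/-- The term of the expansion indexed by `R` (the coordinates contributing their `x`-part) is the
monomial `x^R y^{σ(R ∆ s)}`. -/
theorem twistedTerm_eq (σ : Equiv.Perm (Fin h)) (s R : Finset (Fin h)) :
    ((∏ a ∈ R, (X (Fin.castAdd h a) * if a ∈ s then 1 else X (Fin.natAdd h (σ a)))) *
      ∏ a ∈ univ \ R, (if a ∈ s then X (Fin.natAdd h (σ a)) else 1) :
        MvPolynomial (Fin (h + h)) ℂ) =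
    (∏ a ∈ R, X (Fin.castAdd h a)) * ∏ c ∈ (symmDiff R s).image σ, X (Fin.natAdd h c) := by
  classical
  rw [Finset.prod_mul_distrib, mul_assoc]
  congr 1
  -- the y-part: ∏_{a ∈ R \ s} y_{σ a} * ∏_{a ∈ s \ R} y_{σ a} = ∏_{c ∈ σ(R ∆ s)} y_c
  rw [Finset.prod_image (fun a _ b _ hab => σ.injective hab)]
  have h1 : (∏ a ∈ R, (if a ∈ s then (1 : MvPolynomial (Fin (h + h)) ℂ) else X (Fin.natAdd h (σ a))))
      = ∏ a ∈ R \ s, X (Fin.natAdd h (σ a)) := by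
    rw [← Finset.prod_filter_mul_prod_filter_not R (fun a => a ∈ s)]
    rw [Finset.prod_congr rfl (fun a ha => if_pos (Finset.mem_filter.mp ha).2), Finset.prod_const_one,
      one_mul]
    rw [Finset.prod_congr rfl (fun a ha => if_neg (Finset.mem_filter.mp ha).2)]
    congr 1
    ext a
    simp [Finset.mem_sdiff]
  have h2 : (∏ a ∈ univ \ R, (if a ∈ s then X (Fin.natAdd h (σ a)) else (1 : MvPolynomial (Fin (h + h)) ℂ)))
      = ∏ a ∈ s \ R, X (Fin.natAdd h (σ a)) := by
    rw [← Finset.prod_filter_mul_prod_filter_not (univ \ R) (fun a => a ∈ s)]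
    rw [Finset.prod_congr rfl (fun a ha => if_pos (Finset.mem_filter.mp ha).2)]
    rw [Finset.prod_congr rfl (fun a ha => if_neg (Finset.mem_filter.mp ha).2), Finset.prod_const_one,
      mul_one]
    congr 1
    ext a
    simp [Finset.mem_sdiff, and_comm]
  rw [h1, h2, ← Finset.prod_union disjoint_sdiff_sdiff]
  rfl

/-- **Coefficients of the twisted diagonal state**: `coeff_{x^U y^W} f_T = [W = σ(U ∆ s)]`. -/
theorem coeff_twistedDiag (σ : Equiv.Perm (Fin h)) (s U W : Finset (Fin h)) :
    coeff (∑ a ∈ U, Finsupp.single (Fin.castAdd h a) 1 + ∑ c ∈ W, Finsupp.single (Fin.natAdd h c) 1)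
      (∏ a : Fin h, (if a ∈ s then X (Fin.natAdd h (σ a)) + X (Fin.castAdd h a)
        else 1 + X (Fin.castAdd h a) * X (Fin.natAdd h (σ a))) : MvPolynomial (Fin (h + h)) ℂ) =
      if W = (symmDiff U s).image σ then 1 else 0 := by
  classical
  simp_rw [twistedFactor_eq_add]
  rw [Finset.prod_add, coeff_sum]
  simp_rw [twistedTerm_eq, prod_X_mul_prod_X_eq_monomial, coeff_monomial, partitionExpo_eq_iff]
  rw [Finset.powerset_univ]
  by_cases hW : W = (symmDiff U s).image σ
  · rw [if_pos hW, Finset.sum_eq_single U]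
    · rw [if_pos ⟨rfl, hW.symm⟩]
    · intro R _ hR
      rw [if_neg (fun hh => hR hh.1)]
    · intro hU
      exact absurd (mem_univ U) hU
  · rw [if_neg hW]
    refine Finset.sum_eq_zero fun R _ => ?_
    rw [if_neg]
    rintro ⟨rfl, hRW⟩
    exact hW hRW.symm

/-- The twisted diagonal state lies in `SmallCircuits ℂ (h+h) 2` (`h ≥ 1`): degree `≤ 2h`, size `≤ 3h`. -/
theorem twistedDiag_mem_smallCircuits (hh : 1 ≤ h) (σ : Equiv.Perm (Fin h)) (s : Finset (Fin h)) :
    (∏ a : Fin h, (if a ∈ s then X (Fin.natAdd h (σ a)) + X (Fin.castAdd h a)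
        else 1 + X (Fin.castAdd h a) * X (Fin.natAdd h (σ a))) : MvPolynomial (Fin (h + h)) ℂ) ∈
      SmallCircuits ℂ (h + h) 2 := by
  have hdeg : ∀ a : Fin h, ((if a ∈ s then X (Fin.natAdd h (σ a)) + X (Fin.castAdd h a)
      else 1 + X (Fin.castAdd h a) * X (Fin.natAdd h (σ a))) : MvPolynomial (Fin (h + h)) ℂ).totalDegree
      ≤ 2 := by
    intro a
    by_cases ha : a ∈ s
    · rw [if_pos ha]
      refine (totalDegree_add _ _).trans (max_le ?_ ?_) <;> rw [totalDegree_X] <;> norm_num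
    · rw [if_neg ha]
      refine (totalDegree_add _ _).trans (max_le ?_ ?_)
      · rw [totalDegree_one]; exact Nat.zero_le _
      · exact (totalDegree_mul _ _).trans (by rw [totalDegree_X, totalDegree_X])
  have hsize : ∀ a : Fin h, complexity ((if a ∈ s then X (Fin.natAdd h (σ a)) + X (Fin.castAdd h a)
      else 1 + X (Fin.castAdd h a) * X (Fin.natAdd h (σ a))) : MvPolynomial (Fin (h + h)) ℂ) ≤ 2 := by
    intro a
    by_cases ha : a ∈ s
    · rw [if_pos ha]
      calc _ ≤ complexity (X (Fin.natAdd h (σ a)) : MvPolynomial (Fin (h + h)) ℂ) +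
            complexity (X (Fin.castAdd h a) : MvPolynomial (Fin (h + h)) ℂ) + 1 :=
            complexity_add_le_holds _ _
        _ ≤ 2 := by rw [complexity_X_holds, complexity_X_holds]; norm_num
    · rw [if_neg ha]
      calc _ ≤ complexity (1 : MvPolynomial (Fin (h + h)) ℂ) +
            complexity (X (Fin.castAdd h a) * X (Fin.natAdd h (σ a)) : MvPolynomial (Fin (h + h)) ℂ) +
            1 := complexity_add_le_holds _ _
        _ ≤ 0 + (complexity (X (Fin.castAdd h a) : MvPolynomial (Fin (h + h)) ℂ) +
            complexity (X (Fin.natAdd h (σ a)) : MvPolynomial (Fin (h + h)) ℂ) + 1) + 1 := by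
            gcongr
            · rw [← C_1, complexity_C_holds]
            · exact complexity_mul_le_holds _ _
        _ = 2 := by rw [complexity_X_holds, complexity_X_holds]
  refine ⟨?_, ?_⟩
  · calc _ ≤ ∑ a : Fin h, ((if a ∈ s then X (Fin.natAdd h (σ a)) + X (Fin.castAdd h a)
          else 1 + X (Fin.castAdd h a) * X (Fin.natAdd h (σ a))) :
            MvPolynomial (Fin (h + h)) ℂ).totalDegree := totalDegree_finsetProd _ _
      _ ≤ ∑ _a : Fin h, 2 := Finset.sum_le_sum fun a _ => hdeg a
      _ = h + h := by simp; ring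
  · calc _ ≤ ∑ a : Fin h, complexity ((if a ∈ s then X (Fin.natAdd h (σ a)) + X (Fin.castAdd h a)
          else 1 + X (Fin.castAdd h a) * X (Fin.natAdd h (σ a))) : MvPolynomial (Fin (h + h)) ℂ) +
          (univ : Finset (Fin h)).card := complexity_finset_prod_le _ _
      _ ≤ ∑ _a : Fin h, 2 + (univ : Finset (Fin h)).card := by
          gcongr with a _
          exact hsize a
      _ = 3 * h := by simp; ring
      _ ≤ (h + h) ^ 2 := by nlinarith

/-- **Automorphic layouts are hit.** If the columns are the image of a rearrangement of the rows
under a cube automorphism `S ↦ σ(S ∆ s)` — `w j = σ((u (κ j)) ∆ s)` — then the layout matrix of item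
19717 at the twisted diagonal state is the permutation matrix of `κ⁻¹`; so the layout is hit inside
`SmallCircuits ℂ (h+h) 2` (`h ≥ 1`, any `r`). -/
theorem partitionMinor_hit_of_automorphic (hh : 1 ≤ h) (r : ℕ) (u w : Fin r → Finset (Fin h))
    (hu : Function.Injective u) (σ : Equiv.Perm (Fin h)) (s : Finset (Fin h))
    (κ : Equiv.Perm (Fin r)) (hw : ∀ j, w j = (symmDiff (u (κ j)) s).image σ) :
    ∃ f ∈ SmallCircuits ℂ (h + h) 2,
      (Matrix.of fun i j : Fin r => MvPolynomial.coeff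
        (∑ a ∈ u i, Finsupp.single (Fin.castAdd h a) 1 +
          ∑ c ∈ w j, Finsupp.single (Fin.natAdd h c) 1) f).det ≠ 0 := by
  classical
  refine ⟨_, twistedDiag_mem_smallCircuits hh σ s, ?_⟩
  have hM : (Matrix.of fun i j : Fin r => MvPolynomial.coeff
        (∑ a ∈ u i, Finsupp.single (Fin.castAdd h a) 1 +
          ∑ c ∈ w j, Finsupp.single (Fin.natAdd h c) 1)
        (∏ a : Fin h, (if a ∈ s then X (Fin.natAdd h (σ a)) + X (Fin.castAdd h a)
          else 1 + X (Fin.castAdd h a) * X (Fin.natAdd h (σ a))) : MvPolynomial (Fin (h + h)) ℂ)) =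
      (κ⁻¹).permMatrix ℂ := by
    have hinj : ∀ A B : Finset (Fin h), (symmDiff A s).image σ = (symmDiff B s).image σ ↔ A = B := by
      intro A B
      constructor
      · intro hAB
        have h1 : symmDiff A s = symmDiff B s :=
          (Finset.image_injective σ.injective) hAB
        simpa [symmDiff_left_inj] using congrArg (fun C => symmDiff C s) h1
      · rintro rfl; rfl
    ext i j
    rw [Matrix.of_apply, coeff_twistedDiag, hw, Equiv.Perm.permMatrix,
      PEquiv.toMatrix_toPEquiv_apply, Pi.single_apply]
    simp only [hinj, hu.eq_iff, Equiv.Perm.inv_def, Equiv.eq_symm_apply]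
  rw [hM, Matrix.det_permutation]
  rcases Int.units_eq_one_or (Equiv.Perm.sign κ⁻¹) with hs | hs <;> simp [hs]

/-- **Translates**: `w j = (u (κ j)) ∆ s` (e.g. even-weight rows against odd-weight columns,
`s = {a}`; pointwise complements, `s = univ`). -/
theorem partitionMinor_hit_of_translate (hh : 1 ≤ h) (r : ℕ) (u w : Fin r → Finset (Fin h))
    (hu : Function.Injective u) (s : Finset (Fin h)) (κ : Equiv.Perm (Fin r))
    (hw : ∀ j, w j = symmDiff (u (κ j)) s) :
    ∃ f ∈ SmallCircuits ℂ (h + h) 2,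
      (Matrix.of fun i j : Fin r => MvPolynomial.coeff
        (∑ a ∈ u i, Finsupp.single (Fin.castAdd h a) 1 +
          ∑ c ∈ w j, Finsupp.single (Fin.natAdd h c) 1) f).det ≠ 0 :=
  partitionMinor_hit_of_automorphic hh r u w hu (Equiv.refl _) s κ fun j => by
    rw [hw j, Equiv.coe_refl, Finset.image_id]

end

end Summit.ValiantsHypothesis.ValiantsHypothesis.Theorems.BarrierLever.Automorphic
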